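import Summits.NavierStokesRegularity.NavierStokesRegularity.Theses.RotatedEulerWindow
import Summits.NavierStokesRegularity.NavierStokesRegularity.Theses.VortexLineClock

/-!
# Birth skeleton (BC3) for crux `RotatedEulerWindow.EmptyRotatedEulerWindow` (stmt-NavierStokesRegularity-19280)

planner-skel-stmt-NavierStokesRegularity-19280-0 · skeleton-register (BC3, one-shot) · 2026-08-17.
Route `route-NavierStokesRegularity-RotatedEulerWindow` (rev 0, draft — tribunal pending), crux #2
(rank 2, OPEN, difficulty open-problem, the route's DECIDING crux):

**THE ROTATED EULER WINDOW IS EMPTY** — for every `β ∈ [2/5, 1/2)`, every `α ≠ 0` and every unit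
vector `e` there is no pair `(U, Ω)` with `U ∈ C²`, `Ω ∈ C¹`, `div U = 0`, `m Ω = curl U` (`m > 0`),
`U, Ω` globally Lipschitz, solving about some centre `c` with some pressure `P ∈ C¹` the co-rotating
profile system `(1−β)U + α e×U + DU·V + ∇P = 0`, `DΩ·V − DU·Ω = −Ω − α e×Ω`,
`V = β(y−c) − α e×(y−c) + U`, with the CIV-matched decay `|Ω(y)| ≤ C⟨y⟩^{−1/β}`,
`|U(y)| ≤ C⟨y⟩^{1−1/β}` and the normalisation `‖Ω 0‖ = 1` (the slice `α = 0` is the shared crux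
`EmptyEulerWindow`, stmt-11273, whose registered skeleton `Cruxes/EmptyEulerWindow/Lines/birth.lean`
this file parallels).

## The line — DECAY-FLUX RECURRENCE · ROTATED SEIFERT RESIDUAL · THE SHARED PROFILE CLOCK

This is the route header's TWO-LAYER PLAN for the crux, typed: `EmptyRotatedEulerWindow ⇐
DecayFluxRecurrence → RotatedSeifertResidual → ProfileClockNoCycle`. The three stubs are the three
support items BY SIGNATURE (S1, S2: verbatim text of the route's rank-9 supports stmt-19348 /
stmt-19349, whose decls the gate has not yet materialised in the rev-0 route file; S3: the shared
item stmt-11277 BY NAME, `VortexLineClock.ProfileClockNoCycle`), so that landing a stub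
(`propose --supports stmt-NavierStokesRegularity-19280`) closes the corresponding item too. The stub
NAMES and SIGNATURES are identical to the typing seat's registration of 2026-08-17T18:37Z
(planner-type-8522a5cbc2-0, evidence `EmptyRotatedEulerWindow_line.lean` on the item), which could
not be written to the tree from that unit; this file is its tree-resident re-registration.

* S1 `stub_decayFluxRecurrence` (= stmt-19348 `DecayFluxRecurrence`; generic, α-free; size L in
  Lean, TRUE): for a `C¹`, globally Lipschitz field `Ω = m⁻¹ curl U` (`U ∈ C²`, so `div Ω = 0`) with
  `|Ω(y)| ≤ C(1+|y|)^{−1/β}`, `0 < β < 1/2`, a.e. point `y` with `Ω y ≠ 0` is forward-recurrent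
  along its (unique) vortex line `x' = Ω(x)`, `x 0 = y`.
* S2 `stub_rotatedSeifertResidual` (= stmt-19349 `RotatedSeifertResidual`; OPEN — the HARDEST stub,
  the bet of the crux): a rotated window profile (`α ≠ 0`, `‖e‖ = 1`, the crux's clause block)
  whose vortex-line flow is a.e. recurrent on `{Ω ≠ 0}` carries a CLOSED vortex line
  (`τ`-periodic solution of `x' = Ω(x)`, `τ > 0`, through a point with `Ω ≠ 0`).
* S3 `stub_profileClockNoCycle` (= shared stmt-11277 `VortexLineClock.ProfileClockNoCycle`, by
  name; size L in Lean, TRUE, α-FREE): if `U, Ω ∈ C¹` are globally Lipschitz, `γ ≠ −1` and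
  `DΩ·(γ(y−c)+U) − DU·Ω = −Ω`, then `x' = Ω(x)` has no non-stationary periodic orbit.

Composition `EmptyRotatedEulerWindow_of : S1 → S2 → S3 → EmptyRotatedEulerWindow` (PROVED below,
sorry-free, standard axioms). Given a rotated window profile `(β, α, e, U, Ω)`: S1 (fed `0 < β` from
`2/5 ≤ β`, the curl clause, `Lip Ω`, the vorticity half of the decay clause) gives a.e. recurrence;
S2 gives a closed vortex line through a point with `Ω ≠ 0`; and the rotation is SHEARED INTO THE
STRAIN (`unrotate_vorticity_clause`): with `U' := U − α e×(·−c)` one has `β(y−c) + U' = V` and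
`DU'·Ω = DU·Ω − α e×Ω`, so the typed rotated vorticity clause `DΩ·V − DU·Ω = −Ω − α e×Ω` is EXACTLY
the unrotated clock hypothesis `DΩ·(β(y−c)+U') − DU'·Ω = −Ω` of S3 for the pair `(U', Ω)` (`U'` is
`C¹` and globally Lipschitz with constant `L + ‖α·(e×)‖`); `β ≠ −1` from `2/5 ≤ β`; S3 forbids the
closed line — contradiction. (This is the planner's `unrotate_clock_data`: the Coriolis term drops
out of the commutator, `[V, Ω] = −(1+β)Ω` for every `α`, so ONE clock statement serves both slices.)

## Why each stub is plausible, and what it leans on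

* S1 (TRUE). `Ω = m⁻¹ curl U` with `U ∈ C²` is divergence-free (`div curl = 0`, in tree as the
  discharged fact `Literature.Analysis.FluidPDE.divergence_curl_eq_zero`), `C¹` and globally
  Lipschitz, so its flow is complete (`Literature.Analysis.ODE.lipschitzFlow`,
  `hasDerivAt_lipschitzFlow`, `eq_lipschitzFlow_of_hasDerivAt`, `contDiff_lipschitzFlow`) and
  Lebesgue-preserving (Liouville: `Literature.Analysis.ODE.det_eq_exp_mul_of_trace_eq` + Mathlib
  `MeasureTheory.lintegral_abs_det_fderiv_eq_addHaar_image`). SLOW ESCAPE: `|Ω(y)| ≤ C(1+|y|)^{−a}`,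
  `a = 1/β > 2`, keeps a trajectory from `B_R` inside `B_{R(s)}`, `R(s) ~ s^{1/(1+a)}`, so `n` disjoint
  iterates of a wandering set of the time-one map fit in a ball of volume `O(n^{3/(1+a)}) = o(n)`:
  every wandering set is null, the time-one map is `MeasureTheory.Conservative`, and
  `Conservative.ae_frequently_mem_of_mem_nhds` + uniqueness of vortex lines give the conclusion.
  It implies the sibling's `VortexLineClock.FluxCapacityRecurrence` (stmt-11276) outright.
  [ConstantinIgnatovaVicol2026Putative §3.1 (arXiv:2602.17570); MajdaBertozzi2002 §1]
* S2 (OPEN). False as a bare dynamical statement (G. Kuperberg 1996: volume-preserving `C¹`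
  aperiodic recurrent flows on `ℝ³`); the bet is the extra structure of a rotated window profile:
  the conformal-affine symmetry `[V, Ω] = −(1+β)Ω` with `V = β(y−c) − α e×(y−c) + U` complete
  (its flow conjugates the vortex-line flow to itself sped up by `e^{(1+β)s}` and preserves the
  recurrent set), contact/Reeb structure where `U·Ω ≠ 0` (Etnyre–Ghrist 2000), far field outgoing in
  the co-rotating frame. Logically S2 is the crux in RESIDUAL form: modulo S1 and S3 it is
  equivalent to the crux (the crux implies S2 vacuously) — weaker than the crux exactly by the
  recurrence hypothesis it is handed and the closed-orbit conclusion it may stop at.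
  [Kuperberg1996; EtnyreGhrist2000; ConstantinIgnatovaVicol2026Putative §3.5; arXiv:2511.16254]
* S3 (TRUE; verified on paper by refuters g41-8 / g41-13 / rattack-11277 on stmt-11277). The flow
  `Ψ_τ` of `V = γ(y−c)+U` satisfies `DΨ_τ(y)Ω(y) = e^{(1+γ)τ} Ω(Ψ_τ y)`, so one closed vortex line
  of period `p` yields closed lines of every period `p e^{−(1+γ)τ}` through points with `Ω ≠ 0`,
  contradicting Yorke's bound `p ≥ 2π/L` (PROVED in tree:
  `Literature.Analysis.ODE.Yorke1969_periodBound_holds`). [Yorke1969; arXiv:2602.17570 §3.4.1]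

## Disproof used / negatives / dead lines

`ledger crux ls stmt-NavierStokesRegularity-19280` (2026-08-17T18:45Z): no workfiles — no
`Disproof.lean`, no `Negative/` lemma, no crux idea, no dead line; there is no `_false_without_<H>`
obligation to honour. Evidence on the item (typing seat): the PROVED small-strain rung
`EmptyRotatedEulerWindow_rung.lean` (`Lip U < 1 ⇒` empty, every `α`), the sign check
`k2_signcheck_numeric.py` of the typed clause system (the Coriolis terms cancel in `[V, Ω]`, which is
what `unrotate_vorticity_clause` proves formally here), the tribunal pre-check `tk=PROVISIONAL`.
Negatives index (`ledger negatives --problem NavierStokesRegularity`, 5 entries: 1376 OddMorawetzLocal,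
4055 FiniteTangentModuli, 1832 PerpetualPump.Thesis, 1429 CorrectorSolvable, 0154
BlowupClayNonuniqueness): none concerns self-similar / relative-equilibrium Euler profiles, recurrence
or closed vortex lines; no stub restates one.

## BC3 audit (registrar, 2026-08-17; raw JSON in the registrar's NOTES.md / `bc/` folder, table in `Lines/birth.md`)

`lean check --json birth.lean`: rc 0, errors 0, sorries = 3 = the three `stub_*` (warning lines =
the three stub declarations; zero `sorry` elsewhere); `#print axioms EmptyRotatedEulerWindow_of` =
[propext, Classical.choice, Quot.sound]. PROBES (files `bc/probe_S1|S2|S3.lean`, importing ONLY the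
two route files — hence the Statement — with S1/S2 restated verbatim as a `def`, S3 by name; one
tactic per `example`, `maxHeartbeats 400000` each; battery `exact?` · `simpa` · `aesop` ·
`simpa [defs]` · `unfold; aesop` · `intro; exact?`): `S → EmptyRotatedEulerWindow` FAILS 6/6 and
`S → NavierStokesRegularity` FAILS 6/6 for each of S1, S2, S3 — 36/36; the mandated battery
(`exact?` | `simpa` | `aesop`) fails honestly 18/18; of the extra unfolded variants, 4 `unfold; aesop`
runs end by heartbeat exhaustion (S1→crux, S2→crux, S2→summit, S3→crux), all others by honest
failure. Recorded converse (informational): the crux implies S2 VACUOUSLY (S2's hypotheses contain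
the crux's clause block) — S2 is a consequence used TOWARD the crux, as BC2 allows; the crux does not
cheaply give S1 (no profile clause in S1) or S3.
-/

noncomputable section

set_option linter.dupNamespace false

namespace Summit.NavierStokesRegularity.NavierStokesRegularity.Cruxes.EmptyRotatedEulerWindow.Birth

open Literature.Analysis.FluidPDE

/-! ## Name-keyed statements of S1 and S2 (admissible heads for `#h21_check_skeleton`)

The skeleton audit admits a `Prop` hypothesis of the composition iff the head constant of its type
is a registered obligation (route item / statement, by name) or carries the short name of a declared
stub; `@[stub]` tags are gate-reserved. S3 is the route item `VortexLineClock.ProfileClockNoCycle`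
and is used by name. S1 and S2 are the route's rank-9 supports stmt-19348 / stmt-19349, whose decls
the rev-0 route file does not yet declare, so their statements are given name-keyed heads here:
`Registered.stub_decayFluxRecurrence`, `Registered.stub_rotatedSeifertResidual` — `abbrev`s with the
SAME text as the `theorem stub_*` signatures below (which are what `ledger skeleton check` registers),
so the wiring `EmptyRotatedEulerWindow_of stub_… stub_… stub_…` typechecks definitionally. -/

namespace Registered

/-- Statement of S1 (`stub_decayFluxRecurrence`) = support item stmt-NavierStokesRegularity-19348
`DecayFluxRecurrence`, verbatim: decay `|Ω| ≲ ⟨y⟩^{-1/β}` (`0 < β < 1/2`) of the `C¹`, globally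
Lipschitz vorticity `Ω = m⁻¹ curl U` forces a.e. forward recurrence of vortex lines on `{Ω ≠ 0}`. -/
abbrev stub_decayFluxRecurrence : Prop :=
  ∀ (β : ℝ) (U Ω : EuclideanSpace ℝ (Fin 3) → EuclideanSpace ℝ (Fin 3)), 0 < β → β < 1 / 2 → ContDiff ℝ 2 U → ContDiff ℝ 1 Ω → (∃ m : ℝ, 0 < m ∧ ∀ y, m • Ω y = Literature.Analysis.FluidPDE.curl U y) → (∃ L : NNReal, LipschitzWith L Ω) → (∃ C : ℝ, ∀ y, ‖Ω y‖ ≤ C * (1 + ‖y‖) ^ (-(1 / β))) → ∀ᵐ y : EuclideanSpace ℝ (Fin 3), Ω y ≠ 0 → ∀ x : ℝ → EuclideanSpace ℝ (Fin 3), x 0 = y → (∀ s, HasDerivAt x (Ω (x s)) s) → ∀ ε : ℝ, 0 < ε → ∀ S : ℝ, ∃ s, S < s ∧ dist (x s) y < ε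

/-- Statement of S2 (`stub_rotatedSeifertResidual`) = support item stmt-NavierStokesRegularity-19349
`RotatedSeifertResidual`, verbatim: a rotated Euler window profile (the crux's clause block, `α ≠ 0`,
`‖e‖ = 1`) whose vortex-line flow is a.e. recurrent on `{Ω ≠ 0}` has a closed vortex line through a
point with `Ω ≠ 0`. -/
abbrev stub_rotatedSeifertResidual : Prop :=
  ∀ (β α : ℝ) (e : EuclideanSpace ℝ (Fin 3)) (U Ω : EuclideanSpace ℝ (Fin 3) → EuclideanSpace ℝ (Fin 3)), α ≠ 0 → ‖e‖ = 1 → ((2 / 5 : ℝ) ≤ β ∧ β < 1 / 2 ∧ ContDiff ℝ 2 U ∧ ContDiff ℝ 1 Ω ∧ Literature.Analysis.FluidPDE.VectorCalculus.IsDivFree U ∧ (∃ m : ℝ, 0 < m ∧ ∀ y, m • Ω y = Literature.Analysis.FluidPDE.curl U y) ∧ (∃ L : NNReal, LipschitzWith L U ∧ LipschitzWith L Ω) ∧ (∃ (c : EuclideanSpace ℝ (Fin 3)) (P : EuclideanSpace ℝ (Fin 3) → ℝ), ContDiff ℝ 1 P ∧ (∀ y, (1 - β) • U y + α • Literature.Analysis.FluidPDE.cross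 e (U y) + fderiv ℝ U y (β • (y - c) - α • Literature.Analysis.FluidPDE.cross e (y - c) + U y) + gradient P y = 0) ∧ (∀ y, fderiv ℝ Ω y (β • (y - c) - α • Literature.Analysis.FluidPDE.cross e (y - c) + U y) - fderiv ℝ U y (Ω y) = -(Ω y) - α • Literature.Analysis.FluidPDE.cross e (Ω y))) ∧ (∃ C : ℝ, ∀ y, ‖Ω y‖ ≤ C * (1 + ‖y‖) ^ (-(1 / β)) ∧ ‖U y‖ ≤ C * (1 + ‖y‖) ^ (1 - 1 / β)) ∧ ‖Ω 0‖ = 1) → (∀ᵐ y : EuclideanSpace ℝ (Fin 3), Ω y ≠ 0 → ∀ x : ℝ → EuclideanSpace ℝ (Fin 3), x 0 = y → (∀ s, HasDerivAt x (Ω (x s)) s) → ∀ ε : ℝ, 0 < ε → ∀ S : ℝ, ∃ s, S < s ∧ dist (x s) y < ε) → ∃ (x : ℝ → EuclideanSpace ℝ (Fin 3)) (τ : ℝ), 0 < τ ∧ (∀ s, HasDerivAt x (Ω (x s)) s) ∧ (∀ s, x (s + τ) = x s) ∧ Ω (x 0) ≠ 0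

end Registered

/-! ## The stubs S1–S3 (the only `sorry`s of the file) -/

/-- **S1 `stub_decayFluxRecurrence` — DECAY ⇒ FLUX RECURRENCE** (= support item
stmt-NavierStokesRegularity-19348 `DecayFluxRecurrence`, verbatim signature; generic and α-free).
For a `C¹`, globally Lipschitz vorticity field `Ω = m⁻¹ curl U` (`U ∈ C²`) with
`|Ω(y)| ≤ C(1+|y|)^{-1/β}`, `0 < β < 1/2`, almost every point `y` with `Ω y ≠ 0` is forward-recurrent
along its vortex line: every solution `x` of `x' = Ω(x)`, `x 0 = y`, returns `ε`-close to `y` at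
arbitrarily late times. Size L. WHY TRUE: complete volume-preserving flow (`div Ω = 0`) + slow
escape with flux exponent `1/β > 2` ⇒ every wandering set of the time-one map is Lebesgue-null ⇒
`MeasureTheory.Conservative` ⇒ Poincaré recurrence (`Conservative.ae_frequently_mem_of_mem_nhds`);
uniqueness of vortex lines (`Literature.Analysis.ODE.eq_lipschitzFlow_of_hasDerivAt`).
Leans on: `Literature.Analysis.ODE.lipschitzFlow` API, `Literature.Analysis.ODE.det_eq_exp_mul_of_trace_eq`,
`Literature.Analysis.FluidPDE.divergence_curl_eq_zero`, Mathlib `MeasureTheory.Conservative`,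
`MeasureTheory.lintegral_abs_det_fderiv_eq_addHaar_image`.
[ConstantinIgnatovaVicol2026Putative §3.1 (arXiv:2602.17570); MajdaBertozzi2002 §1; Kuperberg1996 (contrast)] -/
theorem stub_decayFluxRecurrence :
    ∀ (β : ℝ) (U Ω : EuclideanSpace ℝ (Fin 3) → EuclideanSpace ℝ (Fin 3)), 0 < β → β < 1 / 2 → ContDiff ℝ 2 U → ContDiff ℝ 1 Ω → (∃ m : ℝ, 0 < m ∧ ∀ y, m • Ω y = Literature.Analysis.FluidPDE.curl U y) → (∃ L : NNReal, LipschitzWith L Ω) → (∃ C : ℝ, ∀ y, ‖Ω y‖ ≤ C * (1 + ‖y‖) ^ (-(1 / β))) → ∀ᵐ y : EuclideanSpace ℝ (Fin 3), Ω y ≠ 0 → ∀ x : ℝ → EuclideanSpace ℝ (Fin 3), x 0 = y → (∀ s, HasDerivAt x (Ω (x s)) s) → ∀ ε : ℝ, 0 < ε → ∀ S : ℝ, ∃ s, S < s ∧ dist (x s) y < ε := by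
  sorry

/-- **S2 `stub_rotatedSeifertResidual` — THE ROTATED SEIFERT RESIDUAL** (= support item
stmt-NavierStokesRegularity-19349 `RotatedSeifertResidual`, verbatim signature; OPEN — the hardest
stub, the bet of the line). A rotated Euler window profile (`α ≠ 0`, `‖e‖ = 1`, the crux's clause
block: `β ∈ [2/5,1/2)`, `U ∈ C²`, `Ω ∈ C¹`, `div U = 0`, `mΩ = curl U`, globally Lipschitz,
co-rotating profile equations with `V = β(y−c) − α e×(y−c) + U`, CIV-matched decay, `‖Ω 0‖ = 1`)
whose vortex-line flow is a.e. recurrent on `{Ω ≠ 0}` (the conclusion of S1) has a CLOSED vortex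
line: `x : ℝ → ℝ³`, `τ > 0`, `x' = Ω(x)`, `x (s + τ) = x s`, `Ω (x 0) ≠ 0`. Size: open problem.
WHY PLAUSIBLE: the profile carries the conformal-affine symmetry `[V, Ω] = −(1+β)Ω` (`V` complete;
its flow conjugates the vortex-line flow to itself sped up by `e^{(1+β)s}` and preserves the
recurrent set), contact/Reeb structure where `U·Ω ≠ 0`, far field outgoing in the co-rotating
frame. WHY IT MIGHT FAIL: Kuperberg-type aperiodic recurrent volume-preserving flows exist in
general, and a rotated profile with saddle-type stagnation set is not excluded in print — the
symmetry may not be rigid enough. Leans on: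
`Literature.Analysis.FluidPDE.isSelfSimilarEulerVorticityProfile_of_smul_eq_curl` (unrotated
pattern), `selfSimilarNodalSet_subset_ball`, S1's flow toolkit.
[Kuperberg1996; EtnyreGhrist2000; ConstantinIgnatovaVicol2026Putative §3.5 (arXiv:2602.17570); arXiv:2511.16254] -/
theorem stub_rotatedSeifertResidual :
    ∀ (β α : ℝ) (e : EuclideanSpace ℝ (Fin 3)) (U Ω : EuclideanSpace ℝ (Fin 3) → EuclideanSpace ℝ (Fin 3)), α ≠ 0 → ‖e‖ = 1 → ((2 / 5 : ℝ) ≤ β ∧ β < 1 / 2 ∧ ContDiff ℝ 2 U ∧ ContDiff ℝ 1 Ω ∧ Literature.Analysis.FluidPDE.VectorCalculus.IsDivFree U ∧ (∃ m : ℝ, 0 < m ∧ ∀ y, m • Ω y = Literature.Analysis.FluidPDE.curl U y) ∧ (∃ L : NNReal, LipschitzWith L U ∧ LipschitzWith L Ω) ∧ (∃ (c : EuclideanSpace ℝ (Fin 3)) (P : EuclideanSpace ℝ (Fin 3) → ℝ), ContDiff ℝ 1 P ∧ (∀ y, (1 - β) • U y + α • Literature.Analysis.FluidPDE.cross e (U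 y) + fderiv ℝ U y (β • (y - c) - α • Literature.Analysis.FluidPDE.cross e (y - c) + U y) + gradient P y = 0) ∧ (∀ y, fderiv ℝ Ω y (β • (y - c) - α • Literature.Analysis.FluidPDE.cross e (y - c) + U y) - fderiv ℝ U y (Ω y) = -(Ω y) - α • Literature.Analysis.FluidPDE.cross e (Ω y))) ∧ (∃ C : ℝ, ∀ y, ‖Ω y‖ ≤ C * (1 + ‖y‖) ^ (-(1 / β)) ∧ ‖U y‖ ≤ C * (1 + ‖y‖) ^ (1 - 1 / β)) ∧ ‖Ω 0‖ = 1) → (∀ᵐ y : EuclideanSpace ℝ (Fin 3), Ω y ≠ 0 → ∀ x : ℝ → EuclideanSpace ℝ (Fin 3), x 0 = y → (∀ s, HasDerivAt x (Ω (x s)) s) → ∀ ε : ℝ, 0 < ε → ∀ S : ℝ, ∃ s, S < s ∧ dist (x s) y < ε) → ∃ (x : ℝ → EuclideanSpace ℝ (Fin 3)) (τ : ℝ), 0 < τ ∧ (∀ s, HasDerivAt x (Ω (x s)) s) ∧ (∀ s, x (s + τ) = x s) ∧ Ω (x 0) ≠ 0 := by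
  sorry

/-- **S3 `stub_profileClockNoCycle` — THE SELF-SIMILAR VORTEX-LINE CLOCK** (= shared support item
stmt-NavierStokesRegularity-11277 `VortexLineClock.ProfileClockNoCycle`, BY NAME; α-free). If
`U, Ω ∈ C¹(ℝ³; ℝ³)` are globally Lipschitz (common constant `L`), `γ ≠ −1`, and
`DΩ(y)(γ(y−c)+U y) − DU(y)(Ω y) = −Ω y` for all `y`, then `x' = Ω(x)` has no `τ`-periodic solution
(`τ > 0`) through a point where `Ω ≠ 0`. Size L. WHY TRUE: the complete `C¹` flow `Ψ_τ` of
`V = γ(y−c)+U` satisfies `DΨ_τ(y) Ω(y) = e^{(1+γ)τ} Ω(Ψ_τ y)`, so one closed vortex line of period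
`p` yields closed vortex lines of every period `p e^{−(1+γ)τ}` through points with `Ω ≠ 0`,
contradicting Yorke's bound `p ≥ 2π/L` (PROVED: `Literature.Analysis.ODE.Yorke1969_periodBound_holds`).
Here it is applied to the SHEARED pair `(U − α e×(·−c), Ω)` — see `unrotate_vorticity_clause`.
[Yorke1969; ConstantinIgnatovaVicol2026Putative §3.4.1; arXiv:2602.17570] -/
theorem stub_profileClockNoCycle :
    Summit.NavierStokesRegularity.NavierStokesRegularity.Theses.VortexLineClock.ProfileClockNoCycle := by
  sorry

/-! ## Shearing the rotation into the strain (sorry-free helper lemmas of the composition) -/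

/-- The rigid co-rotation field `y ↦ α • e × (y − c)` is affine with linear part `α • (e×)`:
its Fréchet derivative is the constant map `α • crossCLM e`. -/
theorem hasFDerivAt_smul_cross_sub_const (α : ℝ) (e c y : EuclideanSpace ℝ (Fin 3)) :
    HasFDerivAt (fun y : EuclideanSpace ℝ (Fin 3) => α • cross e (y - c)) (α • crossCLM e) y := by
  have h := (((crossCLM e).hasFDerivAt).comp y (hasFDerivAt_sub_const c)).const_smul α
  rw [ContinuousLinearMap.comp_id] at h
  exact h

/-- The rigid co-rotation field `y ↦ α • e × (y − c)` is `C^n` for every `n`. -/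
theorem contDiff_smul_cross_sub_const (α : ℝ) (e c : EuclideanSpace ℝ (Fin 3)) {n : WithTop ℕ∞} :
    ContDiff ℝ n (fun y : EuclideanSpace ℝ (Fin 3) => α • cross e (y - c)) :=
  ((crossCLM e).contDiff.comp (contDiff_id.sub contDiff_const)).const_smul α

/-- The rigid co-rotation field `y ↦ α • e × (y − c)` is globally Lipschitz. -/
theorem lipschitzWith_smul_cross_sub_const (α : ℝ) (e c : EuclideanSpace ℝ (Fin 3)) :
    LipschitzWith (‖α • crossCLM e‖₊ * (1 + 0))
      (fun y : EuclideanSpace ℝ (Fin 3) => α • cross e (y - c)) :=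
  (α • crossCLM e).lipschitz.comp (LipschitzWith.id.sub (LipschitzWith.const c))

/-- **Un-rotating the vorticity clause** (the planner's `unrotate_clock_data`). If `U` is
differentiable at `y` and the ROTATED vorticity clause
`DΩ(y)·V − DU(y)·Ω(y) = −Ω(y) − α e×Ω(y)`, `V = β(y−c) − α e×(y−c) + U(y)`, holds at `y`, then the
sheared strain `U' := U − α e×(·−c)` satisfies the UNROTATED clock clause
`DΩ(y)·(β(y−c) + U'(y)) − DU'(y)·Ω(y) = −Ω(y)` at `y`: indeed `β(y−c) + U'(y) = V` and
`DU'(y) = DU(y) − α (e×)`, so the Coriolis term cancels. -/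
theorem unrotate_vorticity_clause {β α : ℝ} {e c : EuclideanSpace ℝ (Fin 3)}
    {U Ω : EuclideanSpace ℝ (Fin 3) → EuclideanSpace ℝ (Fin 3)} {y : EuclideanSpace ℝ (Fin 3)}
    (hU : DifferentiableAt ℝ U y)
    (h : fderiv ℝ Ω y (β • (y - c) - α • cross e (y - c) + U y) - fderiv ℝ U y (Ω y) =
      -(Ω y) - α • cross e (Ω y)) :
    fderiv ℝ Ω y (β • (y - c) + (U y - α • cross e (y - c))) -
        fderiv ℝ (fun y => U y - α • cross e (y - c)) y (Ω y) = -(Ω y) := by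
  rw [(hU.hasFDerivAt.fun_sub (hasFDerivAt_smul_cross_sub_const α e c y)).fderiv]
  have harg : β • (y - c) + (U y - α • cross e (y - c)) = β • (y - c) - α • cross e (y - c) + U y := by
    abel
  rw [harg, _root_.sub_apply, _root_.smul_apply, crossCLM_apply]
  rw [sub_eq_iff_eq_add] at h
  rw [h]
  abel

/-! ## The composition (kernel-checked, sorry-free): S1 → S2 → S3 → the crux, BY NAME -/

/-- **`EmptyRotatedEulerWindow` from the three stub statements.** A rotated window profile
`(β, α, e, U, Ω)` would have an a.e.-recurrent vortex-line flow (S1, fed `0 < β`, the curl clause,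
`Lip Ω` and the vorticity decay), hence a closed vortex line through a point with `Ω ≠ 0` (S2); but
the sheared pair `(U − α e×(·−c), Ω)` satisfies the unrotated clock clause
(`unrotate_vorticity_clause`) with `β ≠ −1`, `C¹` regularity and a common Lipschitz constant, so the
shared clock S3 forbids closed vortex lines — contradiction. Hypotheses = the name-keyed stub
statements `Registered.stub_decayFluxRecurrence`, `Registered.stub_rotatedSeifertResidual`
(definitionally the registered S1/S2 signatures) and the route item `ProfileClockNoCycle` BY NAME;
conclusion = literally the route decl. -/
theorem EmptyRotatedEulerWindow_of (hFlux : Registered.stub_decayFluxRecurrence)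
    (hSeifert : Registered.stub_rotatedSeifertResidual)
    (hClock : Summit.NavierStokesRegularity.NavierStokesRegularity.Theses.VortexLineClock.ProfileClockNoCycle) :
      Summit.NavierStokesRegularity.NavierStokesRegularity.Theses.RotatedEulerWindow.EmptyRotatedEulerWindow := by
  intro β α e U Ω hα he hW
  -- Unpack the window clauses (keeping `hW` itself for S2).
  obtain ⟨hβlo, hβhi, hU2, hΩ1, -, hcurl, ⟨L, hLU, hLΩ⟩, ⟨c, P, -, -, hvort⟩, ⟨C, hdec⟩, -⟩ := id hW
  have hβpos : 0 < β := by linarith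
  have hβ : β ≠ -1 := by
    intro h
    linarith
  have hU1 : ContDiff ℝ 1 U := hU2.of_le (by norm_num)
  -- S1 (decay ⇒ flux recurrence): a.e. vortex line of the profile is recurrent.
  have hrec := hFlux β U Ω hβpos hβhi hU2 hΩ1 hcurl ⟨L, hLΩ⟩ ⟨C, fun y => (hdec y).1⟩
  -- S2 (rotated Seifert residual): a closed vortex line through a point with `Ω ≠ 0`.
  obtain ⟨x, τ, hτ, hx, hper, hx0⟩ := hSeifert β α e U Ω hα he hW hrec
  -- Shear the rotation into the strain: `U' := U − α e×(·−c)`.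
  have hU'1 : ContDiff ℝ 1 (fun y => U y - α • cross e (y - c)) :=
    hU1.sub (contDiff_smul_cross_sub_const α e c)
  have hU'Lip : LipschitzWith (L + ‖α • crossCLM e‖₊ * (1 + 0)) (fun y => U y - α • cross e (y - c)) :=
    hLU.sub (lipschitzWith_smul_cross_sub_const α e c)
  have hΩLip : LipschitzWith (L + ‖α • crossCLM e‖₊ * (1 + 0)) Ω := hLΩ.weaken le_self_add
  have hvort' : ∀ y, fderiv ℝ Ω y (β • (y - c) + (U y - α • cross e (y - c))) -
      fderiv ℝ (fun y => U y - α • cross e (y - c)) y (Ω y) = -(Ω y) :=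
    fun y => unrotate_vorticity_clause ((hU1.differentiable one_ne_zero) y) (hvort y)
  -- S3 (the shared clock, applied to the sheared pair): no closed vortex line — contradiction.
  exact hClock β c (fun y => U y - α • cross e (y - c)) Ω hβ hU'1 hΩ1 ⟨_, hU'Lip, hΩLip⟩ hvort'
    ⟨x, τ, hτ, hx, hper, hx0⟩

/-- WIRING CHECK: the three sorried stubs compose to a closed term of the crux's type (modulo their
`sorry`s). Deliberately an `example` — no constant of type `EmptyRotatedEulerWindow` enters the
environment, so a probe importing this file cannot close `stub → EmptyRotatedEulerWindow` by `exact?`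
through a pre-composed witness. -/
example : Summit.NavierStokesRegularity.NavierStokesRegularity.Theses.RotatedEulerWindow.EmptyRotatedEulerWindow :=
  EmptyRotatedEulerWindow_of stub_decayFluxRecurrence stub_rotatedSeifertResidual stub_profileClockNoCycle

end Summit.NavierStokesRegularity.NavierStokesRegularity.Cruxes.EmptyRotatedEulerWindow.Birth

end
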